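import Mathlib
import Summits.NavierStokesRegularity.FluidComputer.TriadSignGeometry
import HarnessLib

/-!
# Locality of exact-coefficient triad gates: the envelope energy density is conserved pointwise

HONEST FRAMING (cell `ns-blowup`, seat `ns-blowup-circuit` g2, human ruling D-0035): this cell ATTEMPTS
the negative direction of the Clay problem; nothing in this file is a claim about Navier–Stokes.
WHAT THIS IS NOT: not a statement about the Navier–Stokes or Euler equations, nor about any
Fourier-restricted PDE; it is the exact ALGEBRAIC core of memo
`run/shared/lean/pub/ns-blowup/CIRCUIT-OBSTRUCTIONS.md` §J.4 ("locality law"): the leading-order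
envelope equations of ONE triad gate between three co-located wave-packet blocks with carriers
`ξ_a + ξ_b = ξ_c + Δ`, evaluated AT ONE POINT `x` of physical space,
  `A_c' = γ_c · A_a A_b · w`,  `A_a' = γ_a · A_c conj(A_b) · conj(w)`,  `A_b' = γ_b · A_c conj(A_a) · conj(w)`
(`w = e^{iΔ·x}` the local mismatch phase — any complex number here), conserve the local energy density
`e = ‖A_a‖² + ‖A_b‖² + ‖A_c‖²` exactly when the coefficients obey the DETAILED CONSERVATION relation
`γ_a + γ_b + conj γ_c = 0` — which the true Euler coefficients of every triad satisfy (per-triad energy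
conservation, memo 0.3; tree `TriadSignGeometry`). Consequence used in the memo: a cascade wired from
such gates hands energy from level to level at the same points with the same density (a pointwise
maximum principle), so it cannot manufacture the spatial concentration `e_n(0) ≍ N_n³ X_n²` that the
`N^{5/2}` coupling of Tao's circuit class presupposes; concentration needs strain (memo J.4 (ii)).

## What is typed
* `gate_rate_re` — the algebra: `Re Σ conj(A_i)·A_i' = Re[(conj γ_a + conj γ_b + γ_c)·(conj A_c · A_a A_b w)]`.
* `gate_rate_eq_zero` — it vanishes under detailed conservation.
* `gate_energy_hasDerivAt`, `gate_energy_deriv_zero` — the same for differentiable amplitudes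
  `A_a, A_b, A_c : ℝ → ℂ` (`d/dt ‖A‖² = 2⟪A, A'⟫_ℝ`, `Complex.inner`).
* `gate_energy_constant` — on `[0,T]` the energy density is constant (`constant_of_has_deriv_right_zero`).
* `gate_energy_le_of_initial` — the pointwise maximum principle for a family of points `x`, each running
  its own gate with its own mismatch phase `w x`.
Honest limits: one gate, leading order of the envelope expansion (the expansion itself is formal in the
memo and NOT asserted here); finitely many gates add their rates and each vanishes by the same lemma.
-/

namespace Summit.NavierStokesRegularity.FluidComputer.EnvelopeGateLocality

open Complex ComplexConjugate Set

/-- THE ALGEBRA OF ONE GATE. With the gate's right-hand sides substituted,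
`Re(conj A_a · A_a' + conj A_b · A_b' + conj A_c · A_c') = Re[(conj γ_a + conj γ_b + γ_c) · (conj A_c · A_a · A_b · w)]`
for arbitrary complex amplitudes `a, b, c`, coefficients `γa, γb, γc` and mismatch phase `w`. -/
theorem gate_rate_re (a b c γa γb γc w : ℂ) :
    (conj a * (γa * c * conj b * conj w) + conj b * (γb * c * conj a * conj w)
        + conj c * (γc * a * b * w)).re
      = ((conj γa + conj γb + γc) * (conj c * a * b * w)).re := by
  -- the first two terms are `γ · conj z` with `z = conj c * a * b * w`; use `Re (γ conj z) = Re (conj γ z)`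
  have hz : conj (conj c * a * b * w) = c * conj a * conj b * conj w := by
    simp only [map_mul, conj_conj]
  have h1 : conj a * (γa * c * conj b * conj w) = γa * conj (conj c * a * b * w) := by
    rw [hz]; ring
  have h2 : conj b * (γb * c * conj a * conj w) = γb * conj (conj c * a * b * w) := by
    rw [hz]; ring
  have hre : ∀ γ z : ℂ, (γ * conj z).re = (conj γ * z).re := by
    intro γ z
    rw [← Complex.conj_re (γ * conj z), map_mul, conj_conj]
  rw [h1, h2, add_re, add_re, hre γa, hre γb, ← add_re, ← add_re]
  congr 1
  ring

/-- DETAILED CONSERVATION KILLS THE RATE: if `γ_a + γ_b + conj γ_c = 0` (per-triad energy conservation of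
the true Euler coefficients) then `Re(conj A_a · A_a' + conj A_b · A_b' + conj A_c · A_c') = 0`. -/
theorem gate_rate_eq_zero {γa γb γc : ℂ} (hγ : γa + γb + conj γc = 0) (a b c w : ℂ) :
    (conj a * (γa * c * conj b * conj w) + conj b * (γb * c * conj a * conj w)
        + conj c * (γc * a * b * w)).re = 0 := by
  have h : conj γa + conj γb + γc = 0 := by
    have := congrArg conj hγ
    simpa [map_add, conj_conj] using this
  rw [gate_rate_re, h, zero_mul, Complex.zero_re]

/-- THE ENERGY-DENSITY RATE OF ONE GATE for differentiable amplitudes `A_a, A_b, A_c : ℝ → ℂ` obeying the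
gate equations at time `t`:
`d/dt (‖A_a‖² + ‖A_b‖² + ‖A_c‖²) = 2 Re[(conj γ_a + conj γ_b + γ_c) · (conj A_c · A_a · A_b · w)]`. -/
theorem gate_energy_hasDerivAt {Aa Ab Ac : ℝ → ℂ} {γa γb γc w : ℂ} {t : ℝ}
    (ha : HasDerivAt Aa (γa * Ac t * conj (Ab t) * conj w) t)
    (hb : HasDerivAt Ab (γb * Ac t * conj (Aa t) * conj w) t)
    (hc : HasDerivAt Ac (γc * Aa t * Ab t * w) t) :
    HasDerivAt (fun s => ‖Aa s‖ ^ 2 + ‖Ab s‖ ^ 2 + ‖Ac s‖ ^ 2)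
      (2 * ((conj γa + conj γb + γc) * (conj (Ac t) * Aa t * Ab t * w)).re) t := by
  have h := (ha.norm_sq.add hb.norm_sq).add hc.norm_sq
  refine h.congr_deriv ?_
  rw [Complex.inner, Complex.inner, Complex.inner, ← gate_rate_re]
  simp only [add_re]
  ring

/-- LOCAL ENERGY DENSITY IS CONSERVED BY A GATE: under detailed conservation `γ_a + γ_b + conj γ_c = 0`
the derivative of `‖A_a‖² + ‖A_b‖² + ‖A_c‖²` at `t` is `0`. -/
theorem gate_energy_deriv_zero {Aa Ab Ac : ℝ → ℂ} {γa γb γc w : ℂ} {t : ℝ}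
    (hγ : γa + γb + conj γc = 0)
    (ha : HasDerivAt Aa (γa * Ac t * conj (Ab t) * conj w) t)
    (hb : HasDerivAt Ab (γb * Ac t * conj (Aa t) * conj w) t)
    (hc : HasDerivAt Ac (γc * Aa t * Ab t * w) t) :
    HasDerivAt (fun s => ‖Aa s‖ ^ 2 + ‖Ab s‖ ^ 2 + ‖Ac s‖ ^ 2) 0 t := by
  have h := gate_energy_hasDerivAt ha hb hc
  have h0 : conj γa + conj γb + γc = 0 := by
    have := congrArg conj hγ
    simpa [map_add, conj_conj] using this
  simpa [h0] using h

/-- CONSTANCY ON AN INTERVAL: if the gate equations hold on `[0,T)` (right-derivatives suffice via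
`HasDerivAt`) and the amplitudes are continuous on `[0,T]`, then the local energy density is constant on
`[0,T]`: `e(t) = e(0)`. -/
theorem gate_energy_constant {Aa Ab Ac : ℝ → ℂ} {γa γb γc w : ℂ} {T : ℝ}
    (hγ : γa + γb + conj γc = 0)
    (hca : ContinuousOn Aa (Icc 0 T)) (hcb : ContinuousOn Ab (Icc 0 T)) (hcc : ContinuousOn Ac (Icc 0 T))
    (ha : ∀ t ∈ Ico 0 T, HasDerivAt Aa (γa * Ac t * conj (Ab t) * conj w) t)
    (hb : ∀ t ∈ Ico 0 T, HasDerivAt Ab (γb * Ac t * conj (Aa t) * conj w) t)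
    (hc : ∀ t ∈ Ico 0 T, HasDerivAt Ac (γc * Aa t * Ab t * w) t) :
    ∀ t ∈ Icc 0 T, ‖Aa t‖ ^ 2 + ‖Ab t‖ ^ 2 + ‖Ac t‖ ^ 2 = ‖Aa 0‖ ^ 2 + ‖Ab 0‖ ^ 2 + ‖Ac 0‖ ^ 2 := by
  have hcont : ContinuousOn (fun s => ‖Aa s‖ ^ 2 + ‖Ab s‖ ^ 2 + ‖Ac s‖ ^ 2) (Icc 0 T) := by
    fun_prop
  have hderiv : ∀ t ∈ Ico 0 T,
      HasDerivWithinAt (fun s => ‖Aa s‖ ^ 2 + ‖Ab s‖ ^ 2 + ‖Ac s‖ ^ 2) 0 (Ici t) t :=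
    fun t ht => (gate_energy_deriv_zero hγ (ha t ht) (hb t ht) (hc t ht)).hasDerivWithinAt
  exact constant_of_has_deriv_right_zero hcont hderiv

/-- THE POINTWISE MAXIMUM PRINCIPLE (memo J.4: "a level hands its energy to the next AT THE SAME POINTS
WITH THE SAME DENSITY"). A family of points `x : X`, each running its own gate with its own mismatch phase
`w x` (= `e^{iΔ·x}`) and the same detailed-conserving coefficients: if the initial local energy density is
`≤ M` at every point, it stays `≤ M` at every point and every time in `[0,T]` — no wiring of such gates
concentrates energy density. -/
theorem gate_energy_le_of_initial {X : Type*} {Aa Ab Ac : X → ℝ → ℂ} {γa γb γc : ℂ} {w : X → ℂ}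
    {T M : ℝ} (hγ : γa + γb + conj γc = 0)
    (hca : ∀ x, ContinuousOn (Aa x) (Icc 0 T)) (hcb : ∀ x, ContinuousOn (Ab x) (Icc 0 T))
    (hcc : ∀ x, ContinuousOn (Ac x) (Icc 0 T))
    (ha : ∀ x, ∀ t ∈ Ico 0 T, HasDerivAt (Aa x) (γa * Ac x t * conj (Ab x t) * conj (w x)) t)
    (hb : ∀ x, ∀ t ∈ Ico 0 T, HasDerivAt (Ab x) (γb * Ac x t * conj (Aa x t) * conj (w x)) t)
    (hc : ∀ x, ∀ t ∈ Ico 0 T, HasDerivAt (Ac x) (γc * Aa x t * Ab x t * w x) t)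
    (hM : ∀ x, ‖Aa x 0‖ ^ 2 + ‖Ab x 0‖ ^ 2 + ‖Ac x 0‖ ^ 2 ≤ M) :
    ∀ x, ∀ t ∈ Icc 0 T, ‖Aa x t‖ ^ 2 + ‖Ab x t‖ ^ 2 + ‖Ac x t‖ ^ 2 ≤ M := by
  intro x t ht
  rw [gate_energy_constant hγ (hca x) (hcb x) (hcc x) (ha x) (hb x) (hc x) t ht]
  exact hM x


/-! ### Finitely many gates (appended by the same seat): the rates add, and each vanishes

A finite family of blocks `i : β` with amplitudes `A i : ℝ → ℂ` and a finite family of gates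
`g : G`, gate `g` coupling the legs `(a g, b g) ↦ c g` with coefficients `γa g, γb g, γc g` and local
mismatch phase `w g`. The right-hand side of block `i` is the SUM over all gates of that gate's
contribution to `i` (three indicator terms: `i` as the output leg `c g`, as input leg `a g`, as input leg `b g`); legs may coincide (self-interaction gates), the bookkeeping is by
indicator sums. Then `d/dt Σ_i ‖A i‖² = Σ_g 2·Re[(conj γa g + conj γb g + γc g)·(conj A_c · A_a · A_b · w g)]`,
which is `0` as soon as every gate is detailed-conserving — memo §J.4's "finitely many gates per
level" clause. -/

section ManyGates

variable {β G : Type*} [Fintype β] [DecidableEq β] [Fintype G]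

omit [Fintype G] in
/-- The energy rate of ONE gate summed over all blocks collapses to the three-leg expression of
`gate_rate_re`: `Σ_i Re(conj X_i · (gate g's contribution to i)) = Re[(conj γa + conj γb + γc)·(conj X_c · X_a · X_b · w)]`. -/
theorem sum_re_conj_mul_gate (a b c : G → β) (γa γb γc w : G → ℂ) (X : β → ℂ) (g : G) :
    ∑ i, (conj (X i) * ((if i = c g then γc g * X (a g) * X (b g) * w g else 0)
        + (if i = a g then γa g * X (c g) * conj (X (b g)) * conj (w g) else 0)
        + (if i = b g then γb g * X (c g) * conj (X (a g)) * conj (w g) else 0))).re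
      = ((conj (γa g) + conj (γb g) + γc g) * (conj (X (c g)) * X (a g) * X (b g) * w g)).re := by
  classical
  rw [← gate_rate_re]
  simp only [mul_add, add_re, Finset.sum_add_distrib, mul_ite, mul_zero,
    apply_ite Complex.re, Complex.zero_re, Finset.sum_ite_eq', Finset.mem_univ, if_true]
  ring

/-- MANY GATES, RATE FORMULA: if every block obeys `A_i' = Σ_g (gate g's contribution to i)` at time `t`, then
`d/dt Σ_i ‖A i‖² = Σ_g 2·Re[(conj γa g + conj γb g + γc g)·(conj A_{c g} · A_{a g} · A_{b g} · w g)]`. -/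
theorem gates_energy_hasDerivAt {A : β → ℝ → ℂ} (a b c : G → β) (γa γb γc w : G → ℂ) {t : ℝ}
    (hA : ∀ i, HasDerivAt (A i) (∑ g, ((if i = c g then γc g * (fun j => A j t) (a g) * (fun j => A j t) (b g) * w g else 0)
        + (if i = a g then γa g * (fun j => A j t) (c g) * conj ((fun j => A j t) (b g)) * conj (w g) else 0)
        + (if i = b g then γb g * (fun j => A j t) (c g) * conj ((fun j => A j t) (a g)) * conj (w g) else 0))) t) :
    HasDerivAt (fun s => ∑ i, ‖A i s‖ ^ 2)
      (∑ g, 2 * ((conj (γa g) + conj (γb g) + γc g)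
        * (conj (A (c g) t) * A (a g) t * A (b g) t * w g)).re) t := by
  classical
  have h : HasDerivAt (fun s => ∑ i, ‖A i s‖ ^ 2)
      (∑ i, 2 * ((∑ g, ((if i = c g then γc g * (fun j => A j t) (a g) * (fun j => A j t) (b g) * w g else 0)
        + (if i = a g then γa g * (fun j => A j t) (c g) * conj ((fun j => A j t) (b g)) * conj (w g) else 0)
        + (if i = b g then γb g * (fun j => A j t) (c g) * conj ((fun j => A j t) (a g)) * conj (w g) else 0))) * conj (A i t)).re) t := by
    have := HasDerivAt.fun_sum (u := Finset.univ) (fun i _ => (hA i).norm_sq)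
    simpa only [Complex.inner] using this
  refine h.congr_deriv ?_
  have key : ∀ i, ((∑ g, ((if i = c g then γc g * (fun j => A j t) (a g) * (fun j => A j t) (b g) * w g else 0)
        + (if i = a g then γa g * (fun j => A j t) (c g) * conj ((fun j => A j t) (b g)) * conj (w g) else 0)
        + (if i = b g then γb g * (fun j => A j t) (c g) * conj ((fun j => A j t) (a g)) * conj (w g) else 0))) * conj (A i t)).re
      = ∑ g, (conj (A i t) * ((if i = c g then γc g * (fun j => A j t) (a g) * (fun j => A j t) (b g) * w g else 0)
        + (if i = a g then γa g * (fun j => A j t) (c g) * conj ((fun j => A j t) (b g)) * conj (w g) else 0)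
        + (if i = b g then γb g * (fun j => A j t) (c g) * conj ((fun j => A j t) (a g)) * conj (w g) else 0))).re := by
    intro i
    rw [Finset.sum_mul, Complex.re_sum]
    refine Finset.sum_congr rfl fun g _ => ?_
    rw [mul_comm]
  simp only [key, Finset.mul_sum]
  rw [Finset.sum_comm]
  refine Finset.sum_congr rfl fun g _ => ?_
  rw [← Finset.mul_sum, sum_re_conj_mul_gate]

/-- MANY GATES, CONSERVATION: if every gate is detailed-conserving (`γa g + γb g + conj (γc g) = 0`,
the per-triad energy law of the true coefficients) then the local energy density `Σ_i ‖A i‖²` has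
derivative `0` — however the blocks are wired. -/
theorem gates_energy_deriv_zero {A : β → ℝ → ℂ} (a b c : G → β) (γa γb γc w : G → ℂ) {t : ℝ}
    (hγ : ∀ g, γa g + γb g + conj (γc g) = 0)
    (hA : ∀ i, HasDerivAt (A i) (∑ g, ((if i = c g then γc g * (fun j => A j t) (a g) * (fun j => A j t) (b g) * w g else 0)
        + (if i = a g then γa g * (fun j => A j t) (c g) * conj ((fun j => A j t) (b g)) * conj (w g) else 0)
        + (if i = b g then γb g * (fun j => A j t) (c g) * conj ((fun j => A j t) (a g)) * conj (w g) else 0))) t) :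
    HasDerivAt (fun s => ∑ i, ‖A i s‖ ^ 2) 0 t := by
  have h := gates_energy_hasDerivAt a b c γa γb γc w hA
  have h0 : ∀ g, conj (γa g) + conj (γb g) + γc g = 0 := by
    intro g
    have := congrArg conj (hγ g)
    simpa [map_add, conj_conj] using this
  simpa [h0] using h

/-- MANY GATES, CONSTANCY on `[0,T]`: detailed conservation at every gate and the wiring equations on
`[0,T)` give `Σ_i ‖A i t‖² = Σ_i ‖A i 0‖²` for all `t ∈ [0,T]` (the max principle over points `x`
follows exactly as in `gate_energy_le_of_initial`). -/
theorem gates_energy_constant {A : β → ℝ → ℂ} (a b c : G → β) (γa γb γc w : G → ℂ) {T : ℝ}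
    (hγ : ∀ g, γa g + γb g + conj (γc g) = 0)
    (hcont : ∀ i, ContinuousOn (A i) (Icc 0 T))
    (hA : ∀ i, ∀ t ∈ Ico 0 T,
      HasDerivAt (A i) (∑ g, ((if i = c g then γc g * (fun j => A j t) (a g) * (fun j => A j t) (b g) * w g else 0)
        + (if i = a g then γa g * (fun j => A j t) (c g) * conj ((fun j => A j t) (b g)) * conj (w g) else 0)
        + (if i = b g then γb g * (fun j => A j t) (c g) * conj ((fun j => A j t) (a g)) * conj (w g) else 0))) t) :
    ∀ t ∈ Icc 0 T, ∑ i, ‖A i t‖ ^ 2 = ∑ i, ‖A i 0‖ ^ 2 := by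
  have hc : ContinuousOn (fun s => ∑ i, ‖A i s‖ ^ 2) (Icc 0 T) :=
    continuousOn_finsetSum _ fun i _ => ((hcont i).norm).pow 2
  have hd : ∀ t ∈ Ico 0 T, HasDerivWithinAt (fun s => ∑ i, ‖A i s‖ ^ 2) 0 (Ici t) t :=
    fun t ht => (gates_energy_deriv_zero a b c γa γb γc w hγ (fun i => hA i t ht)).hasDerivWithinAt
  exact constant_of_has_deriv_right_zero hc hd

end ManyGates


/-! ### The true coefficients ARE detailed-conserving (link to `TriadSignGeometry`)

For a Fourier triad `k + p + q = 0` with helicities `(s_k, s_p, s_q)` the exact Euler interaction is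
Waleffe's pattern `ȧ_k = C_k g (a_p a_q)^*`, `ȧ_p = C_p g (a_q a_k)^*`, `ȧ_q = C_q g (a_k a_p)^*` with ONE
common complex factor `g` and the real pattern `(C_k, C_p, C_q)` of `TriadSignGeometry` (memo 0.3). In the
sum convention of this file (output carrier `ξ_c = -q`, so `A_c = conj a_q`, inputs `A_a = a_k`, `A_b = a_p`)
the gate coefficients are `γ_a = C_k g`, `γ_b = C_p g`, `γ_c = conj (C_q g)`, and detailed conservation
`γ_a + γ_b + conj γ_c = 0` is exactly `TriadSignGeometry.pattern_energy` (`C_k + C_p + C_q = 0`). -/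

section TrueCoefficients

open TriadSignGeometry in
/-- THE TRUE EULER COEFFICIENTS OF A HELICAL TRIAD ARE DETAILED-CONSERVING: with `γ_a = C_k·g`,
`γ_b = C_p·g`, `γ_c = conj(C_q·g)` (Waleffe pattern, common factor `g`), `γ_a + γ_b + conj γ_c = 0`.
Hence every hypothesis `hγ` of this file is discharged for exact-coefficient gates. -/
theorem detailed_conservation_of_pattern (sk sp sq k p q : ℝ) (g γa γb γc : ℂ)
    (ha : γa = (Ck sk sp sq k p q : ℂ) * g) (hb : γb = (Cp sk sp sq k p q : ℂ) * g)
    (hc : γc = conj ((Cq sk sp sq k p q : ℂ) * g)) :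
    γa + γb + conj γc = 0 := by
  have hE := pattern_energy sk sp sq k p q
  rw [ha, hb, hc, conj_conj, ← add_mul, ← add_mul, ← Complex.ofReal_add, ← Complex.ofReal_add, hE]
  simp

open TriadSignGeometry in
/-- COROLLARY (memo §J.4 with true coefficients, one gate at one point): the envelope energy density of an
exact-coefficient helical triad gate is constant on `[0,T]`. -/
theorem gate_energy_constant_of_pattern (sk sp sq k p q : ℝ) (g : ℂ) {Aa Ab Ac : ℝ → ℂ} {w : ℂ} {T : ℝ}
    (hca : ContinuousOn Aa (Icc 0 T)) (hcb : ContinuousOn Ab (Icc 0 T)) (hcc : ContinuousOn Ac (Icc 0 T))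
    (ha : ∀ t ∈ Ico 0 T, HasDerivAt Aa ((Ck sk sp sq k p q : ℂ) * g * Ac t * conj (Ab t) * conj w) t)
    (hb : ∀ t ∈ Ico 0 T, HasDerivAt Ab ((Cp sk sp sq k p q : ℂ) * g * Ac t * conj (Aa t) * conj w) t)
    (hc : ∀ t ∈ Ico 0 T, HasDerivAt Ac (conj ((Cq sk sp sq k p q : ℂ) * g) * Aa t * Ab t * w) t) :
    ∀ t ∈ Icc 0 T, ‖Aa t‖ ^ 2 + ‖Ab t‖ ^ 2 + ‖Ac t‖ ^ 2 = ‖Aa 0‖ ^ 2 + ‖Ab 0‖ ^ 2 + ‖Ac 0‖ ^ 2 :=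
  gate_energy_constant (detailed_conservation_of_pattern sk sp sq k p q g _ _ _ rfl rfl rfl) hca hcb hcc ha hb hc

end TrueCoefficients

end Summit.NavierStokesRegularity.FluidComputer.EnvelopeGateLocality
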